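import Mathlib

/-!
# `MatrixDescartes` — line «finite» / «stamp»: the DIAGONAL-PLUS-RANK-ONE design and its sign certificate
# (algebra and estimates behind the all-`m` rank-one rung `FullyRealisable m ![0,1,m+1] (2m)`, file `…FiniteSectorRankOneRung`)

HONEST FRAMING.  Object-search cell `pub-symmetroid`, seat val-sym-eng-3 g10 (census/instrument ENGINE #3 of D-0148 (b)).
HELPER of the crux item `stmt-ValiantsHypothesis-18050`
(`Summit.ValiantsHypothesis.ValiantsHypothesis.Theses.LacunarySymmetroid.MatrixDescartes`, asymptotic in `K`) with NO closure
claim; no census constant is named here (pure matrix / polynomial / real-inequality lemmas), the realisability statement itself is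
assembled in `…FiniteSectorRankOneRung` from `fullyRealisable_of_certificate`.  Nothing here bears on the crux or on `VP ≠ VNP`.

THE DESIGN (not banded, tropically degenerate — outside every template the cell's search engines enumerate).  Letters
`S₀ = -diag(a_j μ_j)`, `S₁ = diag(μ_j)` (both DIAGONAL) and top letter `γ·J` (`J` = all-ones, rank one), so that
`S₀ + t S₁ + t^{d} (γ J) = diag(μ_j (t - a_j)) + γ t^{d} J` (`rankOneDesign_eval`, symmetric: `rankOneDesign_isSymm`); by the
rank-one matrix determinant lemma (`det_diagonal_add_vecMulVec_const`) and Lagrange interpolation at the distinct nodes `a_j`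
(`lagrange_nodes`), `det = (∏ μ_j) · (∏_j (t - a_j) + γ t^{d} Q(t))` for ANY polynomial `Q` of degree `< m` with `Q(a_j) ≠ 0`
once `μ_j = (∏_{k ≠ j} (a_j - a_k)) / Q(a_j)` (`det_rankOneDesign`; proved off the nodes and extended by a polynomial identity).
§2 is the sign certificate for the choice `a_j = j + 1` (`j ≤ n`), `Q = ∏_{l<n} (t - (l+1)R)`, `γ = (-1)^{n+1} δ`:
`rankOne_sign_low` (at `t = k + ½`, `k ≤ n+1`, the bottom product has sign `(-1)^{k+n+1}` and modulus `≥ (½)^{n+1}`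
— `half_prod_lower` — and beats the top term when `δ (n+2)^{n+2} ((n+1)R)^n < (½)^{n+1}`), `rankOne_sign_node` (at `t = iR`,
`1 ≤ i ≤ n`, the top term vanishes and `det ∝ ∏ (iR - j) > 0`), `rankOne_sign_high` (at `t = (i+½)R`, `i ≤ n` even, the top
term is negative and beats `∏ (t - j) ≤ t^{n+1}` when `δ (R/2)^{n+1} > 1`).
[folklore] Matrix determinant lemma, Lagrange interpolation, elementary real inequalities; no citation is load-bearing.
-/

-- `Summit.ValiantsHypothesis.ValiantsHypothesis.…` repeats a component by the D-0017 layout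
-- (single-conjunct summit), which the `dupNamespace` linter flags; the name is mandated.
set_option linter.dupNamespace false

namespace Summit.ValiantsHypothesis.ValiantsHypothesis.Theorems.LacunarySymmetroidMatrixDescartes.FiniteSector

open scoped BigOperators Matrix
open Polynomial Finset Matrix

/-! ## §1 Algebra of the design: `det (diag(μ_j (t - a_j)) + g·J) = (∏ μ) · (P(t) + g Q(t))` -/

/-- Rank-one matrix determinant lemma for a non-degenerate diagonal plus a constant matrix:
`det (diag(w) + g·J) = (∏ wᵢ) · (1 + ∑ᵢ g / wᵢ)` (`J` = all-ones). [folklore] -/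
theorem det_diagonal_add_vecMulVec_const {ι : Type*} [Fintype ι] [DecidableEq ι] (w : ι → ℝ) (hw : ∀ i, w i ≠ 0) (g : ℝ) :
    (Matrix.diagonal w + Matrix.vecMulVec (fun _ => g) (fun _ => (1 : ℝ))).det = (∏ i, w i) * (1 + ∑ i, g / w i) := by
  have hfac : Matrix.diagonal w + Matrix.vecMulVec (fun _ => g) (fun _ => (1 : ℝ)) =
      Matrix.diagonal w * (1 + Matrix.replicateCol Unit (fun i => g / w i) * Matrix.replicateRow Unit (fun _ => (1 : ℝ))) := by
    rw [← Matrix.vecMulVec_eq Unit, Matrix.mul_add, Matrix.mul_one]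
    congr 1
    ext i k
    rw [Matrix.diagonal_mul, Matrix.vecMulVec_apply, Matrix.vecMulVec_apply]
    have hwi := hw i
    field_simp
  rw [hfac, Matrix.det_mul, Matrix.det_diagonal, Matrix.det_one_add_replicateCol_mul_replicateRow]
  simp [dotProduct, div_eq_mul_inv]

/-- The three letters of the design evaluated at `t`: `S₀ + t S₁ + t^d (γ J) = diag(μ_j (t - a_j)) + (γ t^d)·J`. [folklore] -/
theorem rankOneDesign_eval {m : ℕ} (a μ : Fin m → ℝ) (γ : ℝ) (d : ℕ) (t : ℝ) :
    (∑ l, t ^ (![0, 1, d] : Fin 3 → ℕ) l •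
        (![-Matrix.diagonal (fun j => a j * μ j), Matrix.diagonal μ,
            γ • Matrix.of (fun (_ : Fin m) (_ : Fin m) => (1 : ℝ))] : Fin 3 → Matrix (Fin m) (Fin m) ℝ) l)
      = Matrix.diagonal (fun j => μ j * (t - a j)) + Matrix.vecMulVec (fun _ => γ * t ^ d) (fun _ => (1 : ℝ)) := by
  rw [Fin.sum_univ_three]
  simp only [Matrix.cons_val_zero, Matrix.cons_val_one, Matrix.cons_val_two, Matrix.head_cons,
    Matrix.tail_cons, pow_zero, one_smul, pow_one]
  ext i j
  simp only [Matrix.add_apply, Matrix.neg_apply, Matrix.smul_apply, Matrix.diagonal_apply, Matrix.of_apply,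
    Matrix.vecMulVec_apply, smul_eq_mul]
  split_ifs <;> ring

/-- The letters of the design are symmetric (two diagonal letters and a multiple of the all-ones matrix). [folklore] -/
theorem rankOneDesign_isSymm {m : ℕ} (a μ : Fin m → ℝ) (γ : ℝ) (l : Fin 3) :
    ((![-Matrix.diagonal (fun j => a j * μ j), Matrix.diagonal μ,
        γ • Matrix.of (fun (_ : Fin m) (_ : Fin m) => (1 : ℝ))] : Fin 3 → Matrix (Fin m) (Fin m) ℝ) l).IsSymm := by
  fin_cases l
  · exact (Matrix.isSymm_diagonal (fun j => a j * μ j)).neg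
  · exact Matrix.isSymm_diagonal μ
  · exact (by ext i j; rfl : (Matrix.of (fun (_ : Fin m) (_ : Fin m) => (1 : ℝ))).IsSymm).smul γ

/-- **Lagrange step.**  For distinct nodes `a_j` and a polynomial `Q` of degree `< m`:
`∑_j (Q(a_j) / ∏_{k ≠ j} (a_j - a_k)) · ∏_{k ≠ j} (X - a_k) = Q`. [folklore] -/
theorem lagrange_nodes {m : ℕ} (a : Fin m → ℝ) (ha : Function.Injective a) (Q : ℝ[X]) (hQ : Q.degree < m) :
    ∑ j, C (Q.eval (a j) / ∏ k ∈ univ.erase j, (a j - a k)) * ∏ k ∈ univ.erase j, (X - C (a k)) = Q := by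
  symm
  apply Polynomial.eq_of_degrees_lt_of_eval_index_eq (v := a) univ (ha.injOn.mono (Set.subset_univ _))
  · simpa using hQ
  · -- the interpolating sum has `natDegree ≤ m - 1 < m`
    rcases Nat.eq_zero_or_pos m with hm0 | hm
    · subst hm0
      simp
    have hnat : (∑ j, C (Q.eval (a j) / ∏ k ∈ univ.erase j, (a j - a k)) * ∏ k ∈ univ.erase j, (X - C (a k))).natDegree
        ≤ m - 1 := by
      refine Polynomial.natDegree_sum_le_of_forall_le _ _ fun j _ => ?_
      refine (Polynomial.natDegree_C_mul_le _ _).trans ?_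
      rw [natDegree_finsetProd_X_sub_C_eq_card, Finset.card_erase_of_mem (mem_univ j), card_univ, Fintype.card_fin]
    refine lt_of_le_of_lt (Polynomial.degree_le_natDegree) ?_
    rw [card_univ, Fintype.card_fin]
    exact_mod_cast lt_of_le_of_lt hnat (Nat.sub_lt hm one_pos)
  · intro i _
    rw [Polynomial.eval_finsetSum, Finset.sum_eq_single i]
    · rw [Polynomial.eval_mul, Polynomial.eval_C, Polynomial.eval_prod]
      simp only [Polynomial.eval_sub, Polynomial.eval_X, Polynomial.eval_C]
      have hne : ∏ k ∈ univ.erase i, (a i - a k) ≠ 0 := by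
        refine Finset.prod_ne_zero_iff.2 fun k hk => ?_
        exact sub_ne_zero.2 fun h => (Finset.mem_erase.1 hk).1 (ha h).symm
      field_simp
    · intro j _ hji
      rw [Polynomial.eval_mul, Polynomial.eval_prod]
      have : ∏ k ∈ univ.erase j, (X - C (a k)).eval (a i) = 0 := by
        refine Finset.prod_eq_zero (Finset.mem_erase.2 ⟨fun h => hji (h ▸ rfl), mem_univ i⟩) ?_
        simp
      rw [this, mul_zero]
    · intro h; exact absurd (mem_univ i) h

/-- **The determinant of the design.**  Nodes `a_j` distinct, `Q` of degree `< m` with `Q(a_j) ≠ 0`,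
`μ_j := (∏_{k ≠ j} (a_j - a_k)) / Q(a_j)`; then for every real `t`,
`det (diag(μ_j (t - a_j)) + g·J) = (∏ μ_j) · (∏_j (t - a_j) + g · Q(t))`. [folklore] -/
theorem det_rankOneDesign {m : ℕ} (a μ : Fin m → ℝ) (ha : Function.Injective a) (Q : ℝ[X]) (hQ : Q.degree < m)
    (hQa : ∀ j, Q.eval (a j) ≠ 0) (hμa : ∀ j, μ j = (∏ k ∈ univ.erase j, (a j - a k)) / Q.eval (a j)) (g t : ℝ) :
    (Matrix.diagonal (fun j => μ j * (t - a j)) + Matrix.vecMulVec (fun _ => g) (fun _ => (1 : ℝ))).det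
      = (∏ j, μ j) * (∏ j, (t - a j) + g * Q.eval t) := by
  classical
  have hμ : μ = fun j => (∏ k ∈ univ.erase j, (a j - a k)) / Q.eval (a j) := funext hμa
  have hμne : ∀ j, μ j ≠ 0 := fun j => by
    rw [hμa j]
    refine div_ne_zero (Finset.prod_ne_zero_iff.2 fun k hk => ?_) (hQa j)
    exact sub_ne_zero.2 fun h => (Finset.mem_erase.1 hk).1 (ha h).symm
  -- both sides are polynomial in `t`; we first treat `t` off the nodes
  have key : ∀ s : ℝ, (∀ j, s ≠ a j) →
      (Matrix.diagonal (fun j => μ j * (s - a j)) + Matrix.vecMulVec (fun _ => g) (fun _ => (1 : ℝ))).det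
        = (∏ j, μ j) * (∏ j, (s - a j) + g * Q.eval s) := by
    intro s hs
    have hw : ∀ j, μ j * (s - a j) ≠ 0 := fun j => mul_ne_zero (hμne j) (sub_ne_zero.2 (hs j))
    rw [det_diagonal_add_vecMulVec_const _ hw]
    have hlag := congrArg (Polynomial.eval s) (lagrange_nodes a ha Q hQ)
    rw [Polynomial.eval_finsetSum] at hlag
    simp only [Polynomial.eval_mul, Polynomial.eval_C, Polynomial.eval_prod, Polynomial.eval_sub,
      Polynomial.eval_X] at hlag
    rw [← hlag, Finset.prod_mul_distrib]
    have hterm : ∀ j ∈ (univ : Finset (Fin m)),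
        ((∏ x, μ x) * ∏ x, (s - a x)) * (g / (μ j * (s - a j)))
          = (∏ x, μ x) * (g * ((Q.eval (a j) / ∏ k ∈ univ.erase j, (a j - a k)) * ∏ x ∈ univ.erase j, (s - a x))) := by
      intro j _
      have hsplits : (∏ k, (s - a k)) = (s - a j) * ∏ k ∈ univ.erase j, (s - a k) :=
        (Finset.mul_prod_erase _ _ (mem_univ j)).symm
      have hsj : s - a j ≠ 0 := sub_ne_zero.2 (hs j)
      have hμj := hμne j
      have hinv : Q.eval (a j) / ∏ k ∈ univ.erase j, (a j - a k) = (μ j)⁻¹ := by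
        rw [hμa j, inv_div]
      rw [hsplits, hinv]
      field_simp
    calc ((∏ x, μ x) * ∏ x, (s - a x)) * (1 + ∑ i, g / (μ i * (s - a i)))
        = (∏ x, μ x) * ∏ x, (s - a x) + ∑ i, ((∏ x, μ x) * ∏ x, (s - a x)) * (g / (μ i * (s - a i))) := by
          rw [mul_add, mul_one, Finset.mul_sum]
      _ = (∏ x, μ x) * ∏ x, (s - a x)
            + ∑ i, (∏ x, μ x) * (g * ((Q.eval (a i) / ∏ k ∈ univ.erase i, (a i - a k)) * ∏ x ∈ univ.erase i, (s - a x))) := by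
          rw [Finset.sum_congr rfl hterm]
      _ = (∏ j, μ j) * (∏ j, (s - a j)
            + g * ∑ i, (Q.eval (a i) / ∏ k ∈ univ.erase i, (a i - a k)) * ∏ x ∈ univ.erase i, (s - a x)) := by
          rw [Finset.mul_sum, mul_add, Finset.mul_sum]
  -- pass to all `t` by a polynomial identity: the determinant of the pencil is a polynomial in `t`
  -- we use the one-variable polynomial `L(X) = det (diag(μ_j (X - a_j)) + g J)` written via `Matrix.det` over `ℝ[X]`
  let M : Matrix (Fin m) (Fin m) ℝ[X] :=
    Matrix.diagonal (fun j => C (μ j) * (X - C (a j))) + Matrix.vecMulVec (fun _ => C g) (fun _ => (1 : ℝ[X]))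
  have hM : ∀ s : ℝ, (M.det).eval s
      = (Matrix.diagonal (fun j => μ j * (s - a j)) + Matrix.vecMulVec (fun _ => g) (fun _ => (1 : ℝ))).det := by
    intro s
    have h := RingHom.map_det (Polynomial.evalRingHom s) M
    rw [Polynomial.coe_evalRingHom] at h
    rw [h]
    congr 1
    ext i j
    simp only [M, RingHom.mapMatrix_apply, Matrix.map_apply, Matrix.add_apply, Matrix.diagonal_apply,
      Matrix.vecMulVec_apply, Polynomial.coe_evalRingHom, Polynomial.eval_add]
    split_ifs <;> simp
  let Rhs : ℝ[X] := C (∏ j, μ j) * (∏ j, (X - C (a j)) + C g * Q)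
  have hR : ∀ s : ℝ, Rhs.eval s = (∏ j, μ j) * (∏ j, (s - a j) + g * Q.eval s) := by
    intro s
    simp only [Rhs, Polynomial.eval_mul, Polynomial.eval_C, Polynomial.eval_add, Polynomial.eval_prod,
      Polynomial.eval_sub, Polynomial.eval_X]
  have hpoly : M.det = Rhs := by
    apply Polynomial.eq_of_infinite_eval_eq
    apply Set.Infinite.mono (s := (Set.range a)ᶜ)
    · intro s hs
      have hs' : ∀ j, s ≠ a j := fun j h => hs ⟨j, h.symm⟩
      show M.det.eval s = Rhs.eval s
      rw [hM, hR, key s hs']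
    · exact (Set.finite_range a).infinite_compl
  have := congrArg (Polynomial.eval t) hpoly
  rw [hM, hR] at this
  exact this


/-! ## §2 The sign certificate: `P = ∏_{j=1}^{n+1} (t - j)`, `Q = ∏_{l=1}^{n} (t - lR)`, `γ = (-1)^{n+1} δ` -/

/-- Half-odd-integer products: for `k ≤ N`, `(-1)^{k+N} ∏_{j<N} (k - ½ - j) ≥ (½)^N` (the `k` factors with `j < k` are
`≥ ½`, the `N - k` factors with `j ≥ k` are `≤ -½`). [folklore] -/
theorem half_prod_lower (N k : ℕ) (hk : k ≤ N) :
    (1 / 2 : ℝ) ^ N ≤ (-1 : ℝ) ^ (k + N) * ∏ j ∈ range N, ((k : ℝ) - 1 / 2 - j) := by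
  rw [← Finset.prod_range_mul_prod_Ico _ hk]
  have h1 : (1 / 2 : ℝ) ^ k ≤ ∏ j ∈ range k, ((k : ℝ) - 1 / 2 - j) := by
    calc (1 / 2 : ℝ) ^ k = ∏ _j ∈ range k, (1 / 2 : ℝ) := by rw [Finset.prod_const, Finset.card_range]
      _ ≤ ∏ j ∈ range k, ((k : ℝ) - 1 / 2 - j) := by
          refine Finset.prod_le_prod (fun _ _ => by norm_num) fun j hj => ?_
          have : (j : ℝ) + 1 ≤ k := by exact_mod_cast Finset.mem_range.1 hj
          linarith
  have h2 : ∏ j ∈ Ico k N, ((k : ℝ) - 1 / 2 - j) = (-1 : ℝ) ^ (N - k) * ∏ j ∈ Ico k N, ((j : ℝ) + 1 / 2 - k) := by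
    rw [← Nat.card_Ico k N, ← Finset.prod_const, ← Finset.prod_mul_distrib]
    exact Finset.prod_congr rfl fun j _ => by ring
  have h3 : (1 / 2 : ℝ) ^ (N - k) ≤ ∏ j ∈ Ico k N, ((j : ℝ) + 1 / 2 - k) := by
    calc (1 / 2 : ℝ) ^ (N - k) = ∏ _j ∈ Ico k N, (1 / 2 : ℝ) := by rw [Finset.prod_const, Nat.card_Ico]
      _ ≤ ∏ j ∈ Ico k N, ((j : ℝ) + 1 / 2 - k) := by
          refine Finset.prod_le_prod (fun _ _ => by norm_num) fun j hj => ?_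
          have : (k : ℝ) ≤ j := by exact_mod_cast (Finset.mem_Ico.1 hj).1
          linarith
  have hsign : (-1 : ℝ) ^ (k + N) * (-1 : ℝ) ^ (N - k) = 1 := by
    rw [← pow_add, show k + N + (N - k) = 2 * N by omega, pow_mul]
    norm_num
  have h0k : (0 : ℝ) ≤ (1 / 2 : ℝ) ^ k := by positivity
  have h0N : (0 : ℝ) ≤ (1 / 2 : ℝ) ^ (N - k) := by positivity
  calc (1 / 2 : ℝ) ^ N = (1 / 2 : ℝ) ^ k * (1 / 2) ^ (N - k) := by rw [← pow_add, Nat.add_sub_cancel' hk]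
    _ ≤ (∏ j ∈ range k, ((k : ℝ) - 1 / 2 - j)) * ∏ j ∈ Ico k N, ((j : ℝ) + 1 / 2 - k) :=
        mul_le_mul h1 h3 h0N (h0k.trans h1)
    _ = (-1 : ℝ) ^ (k + N) * ((∏ j ∈ range k, ((k : ℝ) - 1 / 2 - j)) * ∏ j ∈ Ico k N, ((k : ℝ) - 1 / 2 - j)) := by
        rw [h2]
        calc (∏ j ∈ range k, ((k : ℝ) - 1 / 2 - j)) * ∏ j ∈ Ico k N, ((j : ℝ) + 1 / 2 - k)
            = ((-1 : ℝ) ^ (k + N) * (-1 : ℝ) ^ (N - k))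
                * ((∏ j ∈ range k, ((k : ℝ) - 1 / 2 - j)) * ∏ j ∈ Ico k N, ((j : ℝ) + 1 / 2 - k)) := by
                rw [hsign, one_mul]
          _ = _ := by ring

/-- The top product at a half-odd multiple of `R`: `∏_{l<n} (cR - (l+1)R) = R^n ∏_{l<n} (c - 1 - l)`. [folklore] -/
theorem prod_top_scaled (n : ℕ) (c R : ℝ) :
    ∏ l : Fin n, (c * R - ((l : ℝ) + 1) * R) = R ^ n * ∏ l ∈ range n, (c - 1 - (l : ℝ)) := by
  rw [Fin.prod_univ_eq_prod_range (fun l => c * R - ((l : ℝ) + 1) * R) n, ← Finset.card_range n,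
    ← Finset.prod_const, Finset.card_range, ← Finset.prod_mul_distrib]
  exact Finset.prod_congr rfl fun l _ => by ring

/-- **Low points.**  At `t = k + ½` (`k ≤ n+1`) the bottom product `P(t) = ∏_{j ≤ n} (t - (j+1))` has sign `(-1)^{k+n+1}`
and modulus `≥ (½)^{n+1}`, and the top term is smaller once `δ (n+2)^{n+2} ((n+1)R)^n < (½)^{n+1}`. [folklore] -/
theorem rankOne_sign_low (n k : ℕ) (hk : k ≤ n + 1) {R δ : ℝ} (hR : (n : ℝ) + 2 ≤ R) (hδ : 0 ≤ δ)
    (hsmall : δ * ((n : ℝ) + 2) ^ (n + 2) * (((n : ℝ) + 1) * R) ^ n < (1 / 2) ^ (n + 1)) :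
    0 < (-1 : ℝ) ^ (k + (n + 1)) *
      ((∏ j : Fin (n + 1), (((k : ℝ) + 1 / 2) - ((j : ℝ) + 1)))
        + (-1) ^ (n + 1) * δ * ((k : ℝ) + 1 / 2) ^ (n + 2) * ∏ l : Fin n, (((k : ℝ) + 1 / 2) - ((l : ℝ) + 1) * R)) := by
  -- the bottom product
  have hP : (1 / 2 : ℝ) ^ (n + 1) ≤ (-1 : ℝ) ^ (k + (n + 1)) * ∏ j : Fin (n + 1), (((k : ℝ) + 1 / 2) - ((j : ℝ) + 1)) := by
    rw [Fin.prod_univ_eq_prod_range (fun j => ((k : ℝ) + 1 / 2) - ((j : ℝ) + 1)) (n + 1)]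
    have h := half_prod_lower (n + 1) k hk
    have hcongr : ∏ j ∈ range (n + 1), (((k : ℝ) + 1 / 2) - ((j : ℝ) + 1)) = ∏ j ∈ range (n + 1), ((k : ℝ) - 1 / 2 - j) :=
      Finset.prod_congr rfl fun j _ => by ring
    rw [hcongr]
    exact h
  -- the top term is small
  have hR0 : 0 ≤ R := by linarith
  have hE : |(-1 : ℝ) ^ (n + 1) * δ * ((k : ℝ) + 1 / 2) ^ (n + 2) * ∏ l : Fin n, (((k : ℝ) + 1 / 2) - ((l : ℝ) + 1) * R)|
      ≤ δ * ((n : ℝ) + 2) ^ (n + 2) * (((n : ℝ) + 1) * R) ^ n := by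
    rw [abs_mul, abs_mul, abs_mul, abs_pow, abs_neg, abs_one, one_pow, one_mul, abs_of_nonneg hδ, Finset.abs_prod,
      abs_of_nonneg (by positivity : (0 : ℝ) ≤ ((k : ℝ) + 1 / 2) ^ (n + 2))]
    have hk' : (k : ℝ) ≤ n + 1 := by exact_mod_cast hk
    have ht : ((k : ℝ) + 1 / 2) ^ (n + 2) ≤ ((n : ℝ) + 2) ^ (n + 2) :=
      pow_le_pow_left₀ (by positivity) (by linarith) _
    have hq : (∏ l : Fin n, |((k : ℝ) + 1 / 2) - ((l : ℝ) + 1) * R|) ≤ (((n : ℝ) + 1) * R) ^ n := by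
      calc (∏ l : Fin n, |((k : ℝ) + 1 / 2) - ((l : ℝ) + 1) * R|) ≤ ∏ _l : Fin n, (((n : ℝ) + 1) * R) := by
            refine Finset.prod_le_prod (fun _ _ => abs_nonneg _) fun l _ => ?_
            have hl : (l : ℝ) + 1 ≤ n := by exact_mod_cast l.isLt
            have hl0 : (0 : ℝ) ≤ (l : ℝ) := by positivity
            have h1 : (k : ℝ) + 1 / 2 ≤ ((l : ℝ) + 1) * R := by nlinarith
            rw [abs_of_nonpos (by linarith)]
            nlinarith
        _ = (((n : ℝ) + 1) * R) ^ n := by rw [Finset.prod_const, Finset.card_univ, Fintype.card_fin]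
    have hq0 : 0 ≤ (∏ l : Fin n, |((k : ℝ) + 1 / 2) - ((l : ℝ) + 1) * R|) := Finset.prod_nonneg fun _ _ => abs_nonneg _
    have hkt : ((k : ℝ) + 1 / 2) ^ (n + 2) * (∏ l : Fin n, |((k : ℝ) + 1 / 2) - ((l : ℝ) + 1) * R|)
        ≤ ((n : ℝ) + 2) ^ (n + 2) * (((n : ℝ) + 1) * R) ^ n := mul_le_mul ht hq hq0 (by positivity)
    rw [mul_assoc, mul_assoc]
    exact mul_le_mul_of_nonneg_left hkt hδ
  -- combine
  rw [mul_add]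
  have habs : -(δ * ((n : ℝ) + 2) ^ (n + 2) * (((n : ℝ) + 1) * R) ^ n)
      ≤ (-1 : ℝ) ^ (k + (n + 1)) * ((-1) ^ (n + 1) * δ * ((k : ℝ) + 1 / 2) ^ (n + 2)
          * ∏ l : Fin n, (((k : ℝ) + 1 / 2) - ((l : ℝ) + 1) * R)) := by
    have := neg_abs_le ((-1 : ℝ) ^ (k + (n + 1)) * ((-1) ^ (n + 1) * δ * ((k : ℝ) + 1 / 2) ^ (n + 2)
          * ∏ l : Fin n, (((k : ℝ) + 1 / 2) - ((l : ℝ) + 1) * R)))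
    rw [abs_mul, abs_pow, abs_neg, abs_one, one_pow, one_mul] at this
    linarith
  linarith

/-- **Nodes of the top product.**  At `t = iR` (`1 ≤ i ≤ n`) the top term vanishes and the determinant is
`∝ P(iR) > 0`. [folklore] -/
theorem rankOne_sign_node (n i : ℕ) (hi1 : 1 ≤ i) (hi : i ≤ n) {R : ℝ} (hR : (n : ℝ) + 2 ≤ R) (γ : ℝ) :
    0 < (∏ j : Fin (n + 1), ((i : ℝ) * R - ((j : ℝ) + 1)))
        + γ * ((i : ℝ) * R) ^ (n + 2) * ∏ l : Fin n, ((i : ℝ) * R - ((l : ℝ) + 1) * R) := by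
  have hzero : ∏ l : Fin n, ((i : ℝ) * R - ((l : ℝ) + 1) * R) = 0 := by
    refine Finset.prod_eq_zero (Finset.mem_univ (⟨i - 1, by omega⟩ : Fin n)) ?_
    have : (((⟨i - 1, by omega⟩ : Fin n) : ℕ) : ℝ) + 1 = i := by
      simp only
      rw [Nat.cast_sub hi1]
      push_cast
      ring
    rw [this, sub_self]
  rw [hzero, mul_zero, add_zero]
  refine Finset.prod_pos fun j _ => ?_
  have hj : (j : ℝ) + 1 ≤ n + 1 := by exact_mod_cast j.isLt
  have hi' : (1 : ℝ) ≤ i := by exact_mod_cast hi1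
  nlinarith

/-- **High points.**  At `t = (i + ½)R` (`i ≤ n`, `i` even) the top term `(-1)^{n+1} δ t^{n+2} Q(t)` is NEGATIVE of
modulus `≥ δ t^{n+2} (R/2)^n` and beats `P(t) ≤ t^{n+1}` once `δ (R/2)^{n+1} > 1`; so `-det > 0`. [folklore] -/
theorem rankOne_sign_high (n i : ℕ) (hi : i ≤ n) (hie : Even i) {R δ : ℝ} (hR : (2 : ℝ) * (n + 2) ≤ R) (hδ : 0 < δ)
    (hbig : 1 < δ * (R / 2) ^ (n + 1)) :
    0 < -((∏ j : Fin (n + 1), (((i : ℝ) + 1 / 2) * R - ((j : ℝ) + 1)))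
        + (-1) ^ (n + 1) * δ * (((i : ℝ) + 1 / 2) * R) ^ (n + 2)
            * ∏ l : Fin n, (((i : ℝ) + 1 / 2) * R - ((l : ℝ) + 1) * R)) := by
  set t : ℝ := ((i : ℝ) + 1 / 2) * R with ht
  have hR0 : 0 < R := by nlinarith
  have hi0 : (0 : ℝ) ≤ i := by positivity
  have htR : R / 2 ≤ t := by rw [ht]; nlinarith
  have htn : (n : ℝ) + 2 ≤ t := by linarith
  have ht0 : 0 < t := by linarith
  -- bottom product: `0 ≤ P(t) ≤ t^{n+1}`
  have hP : (∏ j : Fin (n + 1), (t - ((j : ℝ) + 1))) ≤ t ^ (n + 1) := by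
    calc (∏ j : Fin (n + 1), (t - ((j : ℝ) + 1))) ≤ ∏ _j : Fin (n + 1), t := by
          refine Finset.prod_le_prod (fun j _ => ?_) fun j _ => ?_
          · have hj : (j : ℝ) + 1 ≤ n + 1 := by exact_mod_cast j.isLt
            linarith
          · have : (0 : ℝ) ≤ (j : ℝ) := by positivity
            linarith
      _ = t ^ (n + 1) := by rw [Finset.prod_const, Finset.card_univ, Fintype.card_fin]
  -- top product: `∏ (t - (l+1)R) = R^n ∏ (i - ½ - l)` and `(-1)^{i+n} ∏ (i - ½ - l) ≥ (½)^n`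
  have hQ : ∏ l : Fin n, (t - ((l : ℝ) + 1) * R) = R ^ n * ∏ l ∈ range n, ((i : ℝ) - 1 / 2 - (l : ℝ)) := by
    rw [ht, prod_top_scaled]
    congr 1
    exact Finset.prod_congr rfl fun l _ => by ring
  have hX := half_prod_lower n i hi
  set X : ℝ := (-1 : ℝ) ^ (i + n) * ∏ j ∈ range n, ((i : ℝ) - 1 / 2 - j) with hXdef
  have hprod : ∏ j ∈ range n, ((i : ℝ) - 1 / 2 - j) = (-1 : ℝ) ^ (i + n) * X := by
    rw [hXdef, ← mul_assoc, ← pow_add, ← two_mul, pow_mul]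
    norm_num
  have hodd : (-1 : ℝ) ^ (n + 1) * (-1 : ℝ) ^ (i + n) = -1 := by
    rw [← pow_add]
    have : Odd (n + 1 + (i + n)) := by
      obtain ⟨r, hr⟩ := hie
      exact ⟨r + n, by omega⟩
    exact this.neg_one_pow
  have hE : (-1 : ℝ) ^ (n + 1) * δ * t ^ (n + 2) * ∏ l : Fin n, (t - ((l : ℝ) + 1) * R)
      = -(δ * t ^ (n + 2) * R ^ n * X) := by
    rw [hQ, hprod]
    calc (-1 : ℝ) ^ (n + 1) * δ * t ^ (n + 2) * (R ^ n * ((-1) ^ (i + n) * X))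
        = ((-1 : ℝ) ^ (n + 1) * (-1) ^ (i + n)) * (δ * t ^ (n + 2) * R ^ n * X) := by ring
      _ = _ := by rw [hodd]; ring
  rw [hE]
  -- sizes
  have hX2 : (1 / 2 : ℝ) ^ n ≤ X := hX
  have h1 : δ * t ^ (n + 2) * (R / 2) ^ n ≤ δ * t ^ (n + 2) * R ^ n * X := by
    have : (R / 2) ^ n = R ^ n * (1 / 2) ^ n := by rw [← mul_pow]; ring_nf
    rw [this, ← mul_assoc]
    have h0 : 0 ≤ δ * t ^ (n + 2) * R ^ n := by positivity
    exact mul_le_mul_of_nonneg_left hX2 h0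
  have h2 : t ^ (n + 1) < δ * t ^ (n + 2) * (R / 2) ^ n := by
    have hRt : δ * (R / 2) ^ (n + 1) ≤ δ * (t * (R / 2) ^ n) := by
      rw [pow_succ']
      exact mul_le_mul_of_nonneg_left (mul_le_mul_of_nonneg_right htR (by positivity)) hδ.le
    have h3 : 1 < δ * (t * (R / 2) ^ n) := lt_of_lt_of_le hbig hRt
    have h4 : 0 < t ^ (n + 1) := by positivity
    calc t ^ (n + 1) = t ^ (n + 1) * 1 := (mul_one _).symm
      _ < t ^ (n + 1) * (δ * (t * (R / 2) ^ n)) := mul_lt_mul_of_pos_left h3 h4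
      _ = δ * t ^ (n + 2) * (R / 2) ^ n := by ring
  linarith

end Summit.ValiantsHypothesis.ValiantsHypothesis.Theorems.LacunarySymmetroidMatrixDescartes.FiniteSector
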